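import Literature.MathematicalPhysics.QuantumFieldTheory.LatticeConvolution
import Literature.Analysis.FunctionSpaces.LatticeFourierCalculus
import HarnessLib

/-!
# `ℓ²` norms of lattice chains in Fourier space: convolution multipliers, `‖A‖₂²` as an integral,
and the bound `‖d₁φ‖² ≤ 2 ∫ μ ∑ₖ |φ̂ₖ|²`

Support file (module "P4c") for the lattice potential theory of the four-dimensional `U(1)` gauge
theory (proof programme of the named fact
`Literature.MathematicalPhysics.QuantumFieldTheory.FrohlichSpencerU1PerimeterLawD4`;
Fröhlich–Spencer 1982 §2.5, (2.88)): the Fourier-side evaluation of the two error terms of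
`LatticeConvolution.sub_div₃_d₂_conv₂`. Everything is proved; no named fact is introduced.

* `latF_conv : (p ∗ F)^ = p̂ · F̂` (`p̂ = latFT S p`), `latF_sub_conv_negLap₀ :
  (F - p ∗ (-ΔF))^ = (1 - p̂ μ) F̂`;
* `pair₂_self_eq_integral : ⟪A, A⟫₂ = ½ ∑_{k,l} ∫ ‖Â_{kl}‖²` (Plancherel, componentwise);
* `latF_d₁_apply : (d₁φ)^_{kl} = (1 - e_{-e_l}) φ̂_k - (1 - e_{-e_k}) φ̂_l` and
  `pair₂_d₁_self_le : ⟪d₁φ, d₁φ⟫₂ ≤ 2 ∫ μ ∑ₖ ‖φ̂ₖ‖²`.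

## References

* J. Fröhlich, T. Spencer, Comm. Math. Phys. 83 (1982) 411–454, §2.3 (2.14), §2.5, §2.10 (2.88).
  [FrohlichSpencerCMP1982]
-/

noncomputable section

open MeasureTheory Finset Function Complex Literature.Probability.LatticeModels
open Literature.Analysis.FunctionSpaces
open Literature.Analysis.FunctionSpaces.LatticeFourier hiding e
open scoped Real ComplexConjugate

namespace Literature.MathematicalPhysics.QuantumFieldTheory

namespace LatticeChain

open LatticeForm (e d₁ d₂)

variable {d : ℕ}

/-! ### Convolution is a Fourier multiplier -/

/-- **`(p ∗ F)^ = p̂ · F̂`** for a kernel read on `S ⊇ supp p` and a finitely supported `F`. [folklore] -/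
theorem latF_conv (S : Finset (Site d)) (p : Site d → ℝ) {F : Site d → ℝ} (hF : HasFiniteSupport F)
    (x : UnitAddTorus (Fin d)) :
    latF (conv S p F) x = latFT S p x * latF F x := by
  have hz : ∀ z ∈ S, HasFiniteSupport fun y => p z * F (y - z) := fun z _ =>
    (hasFiniteSupport_comp_sub hF z).subset (Function.support_mul_subset_right _ _)
  have h1 : conv S p F = fun y => ∑ z ∈ S, (fun z y => p z * F (y - z)) z y := rfl
  rw [h1, latF_finset_sum S hz x, latFT_apply, Finset.sum_mul]
  refine Finset.sum_congr rfl fun z _ => ?_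
  rw [latF_const_mul (p z) (hasFiniteSupport_comp_sub hF z), latF_comp_sub hF]
  ring

/-- `negLap₀` is the `secondDiff` of `LatticeFourierCalculus`. [folklore] -/
theorem negLap₀_eq_secondDiff (F : Site d → ℝ) : negLap₀ F = secondDiff F := rfl

/-- `negLap₀` preserves finite support. [folklore] -/
theorem hasFiniteSupport_negLap₀ {F : Site d → ℝ} (hF : HasFiniteSupport F) :
    HasFiniteSupport (negLap₀ F) :=
  Function.HasFiniteSupport.sum (fun i : Fin d =>
    (hF.sub (hasFiniteSupport_comp_add hF (e i))).add (hF.sub (hasFiniteSupport_comp_sub hF (e i))))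
    Finset.univ

/-- **`(F - p ∗ (-ΔF))^ = (1 - p̂ μ) F̂`**. [folklore] -/
theorem latF_sub_conv_negLap₀ (S : Finset (Site d)) (p : Site d → ℝ) {F : Site d → ℝ}
    (hF : HasFiniteSupport F) (x : UnitAddTorus (Fin d)) :
    latF (F - conv S p (negLap₀ F)) x =
      (1 - latFT S p x * ((latticeDispersion x : ℝ) : ℂ)) * latF F x := by
  rw [latF_sub hF (hasFiniteSupport_conv S p (hasFiniteSupport_negLap₀ hF)), Pi.sub_apply,
    latF_conv S p (hasFiniteSupport_negLap₀ hF), negLap₀_eq_secondDiff, latF_secondDiff hF]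
  ring

/-! ### `⟪A, A⟫₂` as an integral -/

/-- The components of a finitely supported 2-tensor are finitely supported. [folklore] -/
theorem hasFiniteSupport_component₂ {A : Site d → Fin d → Fin d → ℝ} (hA : HasFiniteSupport A)
    (k l : Fin d) : HasFiniteSupport fun y => A y k l :=
  hasFiniteSupport_of_imp hA fun y h0 => by simp [h0]

/-- The components of a finitely supported 1-tensor are finitely supported. [folklore] -/
theorem hasFiniteSupport_component₁ {φ : Site d → Fin d → ℝ} (hφ : HasFiniteSupport φ)
    (k : Fin d) : HasFiniteSupport fun y => φ y k :=
  hasFiniteSupport_of_imp hφ fun y h0 => by simp [h0]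

/-- **`⟪A, A⟫₂ = ½ ∑_{k,l} ∫ ‖Â_{kl}‖²`** (Plancherel componentwise). [cite: FrohlichSpencerCMP1982, §2.3 (2.14)] -/
theorem pair₂_self_eq_integral {A : Site d → Fin d → Fin d → ℝ} (hA : HasFiniteSupport A) :
    pair₂ A A = (1 / 2) * ∑ k, ∑ l, ∫ x, ‖latF (fun y => A y k l) x‖ ^ 2 := by
  unfold pair₂
  congr 1
  have hs : ∀ k l : Fin d, Summable fun y => A y k l * A y k l := fun k l =>
    summable_of_hasFiniteSupport ((hasFiniteSupport_component₂ hA k l).mul_left _)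
  rw [Summable.tsum_finsetSum fun k _ => summable_sum fun l _ => hs k l]
  refine Finset.sum_congr rfl fun k _ => ?_
  rw [Summable.tsum_finsetSum fun l _ => hs k l]
  refine Finset.sum_congr rfl fun l _ => ?_
  rw [integral_norm_sq_latF (hasFiniteSupport_component₂ hA k l)]
  exact tsum_congr fun y => by ring

/-! ### The bound on `‖d₁φ‖²` -/

/-- **`(d₁φ)^_{kl} = (1 - e_{-e_l}) φ̂_k - (1 - e_{-e_k}) φ̂_l`**. [folklore] -/
theorem latF_d₁_apply {φ : Site d → Fin d → ℝ} (hφ : HasFiniteSupport φ) (k l : Fin d)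
    (x : UnitAddTorus (Fin d)) :
    latF (fun y => d₁ φ y k l) x =
      (1 - UnitAddTorus.mFourier (-e l) x) * latF (fun y => φ y k) x -
        (1 - UnitAddTorus.mFourier (-e k) x) * latF (fun y => φ y l) x := by
  have hk := hasFiniteSupport_component₁ hφ k
  have hl := hasFiniteSupport_component₁ hφ l
  have hk' : HasFiniteSupport fun y => φ (y + e l) k := hasFiniteSupport_comp_add hk (e l)
  have hl' : HasFiniteSupport fun y => φ (y + e k) l := hasFiniteSupport_comp_add hl (e k)
  have h1 : (fun y => d₁ φ y k l) =
      ((fun y => φ y k) + fun y => φ (y + e k) l) - ((fun y => φ (y + e l) k) + fun y => φ y l) := by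
    funext y; simp [LatticeForm.d₁]; ring
  rw [h1, latF_sub (hk.add hl') (hk'.add hl), latF_add hk hl', latF_add hk' hl]
  simp only [Pi.add_apply, Pi.sub_apply]
  rw [latF_comp_add hl (e k), latF_comp_add hk (e l)]
  ring

/-- `‖a - b‖² ≤ 2‖a‖² + 2‖b‖²` in `ℂ`. [folklore] -/
theorem norm_sub_sq_le (a b : ℂ) : ‖a - b‖ ^ 2 ≤ 2 * ‖a‖ ^ 2 + 2 * ‖b‖ ^ 2 := by
  have h1 : ‖a - b‖ ≤ ‖a‖ + ‖b‖ := norm_sub_le a b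
  have h2 : ‖a - b‖ ^ 2 ≤ (‖a‖ + ‖b‖) ^ 2 := pow_le_pow_left₀ (norm_nonneg _) h1 2
  nlinarith [sq_nonneg (‖a‖ - ‖b‖)]

/-- Pointwise bound on the components of `(d₁φ)^`:
`‖(d₁φ)^_{kl}‖² ≤ 2‖𝐞(x_l) - 1‖² ‖φ̂_k‖² + 2‖𝐞(x_k) - 1‖² ‖φ̂_l‖²`. [folklore] -/
theorem norm_sq_latF_d₁_le {φ : Site d → Fin d → ℝ} (hφ : HasFiniteSupport φ) (k l : Fin d)
    (x : UnitAddTorus (Fin d)) :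
    ‖latF (fun y => d₁ φ y k l) x‖ ^ 2 ≤
      2 * (‖(fourier 1 (x l) : ℂ) - 1‖ ^ 2 * ‖latF (fun y => φ y k) x‖ ^ 2) +
        2 * (‖(fourier 1 (x k) : ℂ) - 1‖ ^ 2 * ‖latF (fun y => φ y l) x‖ ^ 2) := by
  rw [latF_d₁_apply hφ]
  refine (norm_sub_sq_le _ _).trans (le_of_eq ?_)
  rw [norm_mul, norm_mul, mul_pow, mul_pow, norm_sub_rev (1 : ℂ), norm_sub_rev (1 : ℂ),
    norm_mFourier_neg_single_sub_one, norm_mFourier_neg_single_sub_one]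

/-- **`⟪d₁φ, d₁φ⟫₂ ≤ 2 ∫ μ ∑ₖ ‖φ̂ₖ‖²`** for a finitely supported real 1-tensor `φ`. [folklore] -/
theorem pair₂_d₁_self_le {φ : Site d → Fin d → ℝ} (hφ : HasFiniteSupport φ) :
    pair₂ (d₁ φ) (d₁ φ) ≤
      2 * ∫ x : UnitAddTorus (Fin d), latticeDispersion x * ∑ k, ‖latF (fun y => φ y k) x‖ ^ 2 := by
  have hd : HasFiniteSupport (d₁ φ) :=
    hasFiniteSupport_of_imp_add hφ fun y h0 h1 => by
      funext k l
      simp [LatticeForm.d₁, h0, h1 k, h1 l]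
  rw [pair₂_self_eq_integral hd]
  -- componentwise integrands and their integrability
  set w : Fin d → UnitAddTorus (Fin d) → ℝ := fun k x => ‖(fourier 1 (x k) : ℂ) - 1‖ ^ 2 with hw
  set N : Fin d → UnitAddTorus (Fin d) → ℝ := fun k x => ‖latF (fun y => φ y k) x‖ ^ 2 with hN
  have hwc : ∀ k, Continuous (w k) := fun k =>
    (continuous_norm.comp (((fourier 1).continuous.comp (continuous_apply k)).sub continuous_const)).pow 2
  have hNc : ∀ k, Continuous (N k) := fun k =>
    (continuous_norm.comp (continuous_latF (hasFiniteSupport_component₁ hφ k))).pow 2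
  have hint : ∀ k l, Integrable (fun x => 2 * (w l x * N k x) + 2 * (w k x * N l x)) volume :=
    fun k l => ((continuous_const.mul ((hwc l).mul (hNc k))).add
      (continuous_const.mul ((hwc k).mul (hNc l)))).integrable_unitAddTorus
  have hle : ∀ k l, ∫ x, ‖latF (fun y => d₁ φ y k l) x‖ ^ 2 ≤
      ∫ x, (2 * (w l x * N k x) + 2 * (w k x * N l x)) := fun k l =>
    integral_mono ((continuous_norm.comp (continuous_latF
      (hasFiniteSupport_component₂ hd k l))).pow 2).integrable_unitAddTorus (hint k l)
      fun x => norm_sq_latF_d₁_le hφ k l x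
  have hsum : ∑ k, ∑ l, ∫ x, ‖latF (fun y => d₁ φ y k l) x‖ ^ 2 ≤
      ∑ k, ∑ l, ∫ x, (2 * (w l x * N k x) + 2 * (w k x * N l x)) :=
    Finset.sum_le_sum fun k _ => Finset.sum_le_sum fun l _ => hle k l
  -- evaluate the right-hand side
  have hI : ∀ k l, Integrable (fun x => w l x * N k x) volume := fun k l =>
    ((hwc l).mul (hNc k)).integrable_unitAddTorus
  have hD : ∑ k, ∑ l, ∫ x, w l x * N k x = ∫ x, latticeDispersion x * ∑ k, N k x := by
    have h1 : ∀ k, ∑ l, ∫ x, w l x * N k x = ∫ x, ∑ l, w l x * N k x := fun k =>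
      (integral_finsetSum _ fun l _ => hI k l).symm
    simp_rw [h1]
    rw [← integral_finsetSum _ fun k _ => integrable_finsetSum _ fun l _ => hI k l]
    refine integral_congr_ae (ae_of_all _ fun x => ?_)
    simp only [Finset.mul_sum]
    refine Finset.sum_congr rfl fun k _ => ?_
    rw [← Finset.sum_mul]
    simp only [hw, latticeDispersion]
  have hrhs : ∑ k, ∑ l, ∫ x, (2 * (w l x * N k x) + 2 * (w k x * N l x)) =
      4 * ∫ x, latticeDispersion x * ∑ k, N k x := by
    have h1 : ∀ k l, ∫ x, (2 * (w l x * N k x) + 2 * (w k x * N l x)) =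
        2 * (∫ x, w l x * N k x) + 2 * (∫ x, w k x * N l x) := fun k l => by
      rw [integral_add ((hI k l).const_mul 2) ((hI l k).const_mul 2), integral_const_mul,
        integral_const_mul]
    simp_rw [h1, Finset.sum_add_distrib, ← Finset.mul_sum]
    rw [Finset.sum_comm (f := fun k l => ∫ x, w k x * N l x), hD]
    ring
  calc (1 / 2 : ℝ) * ∑ k, ∑ l, ∫ x, ‖latF (fun y => d₁ φ y k l) x‖ ^ 2
      ≤ (1 / 2) * (4 * ∫ x, latticeDispersion x * ∑ k, N k x) := by
        rw [← hrhs]; exact mul_le_mul_of_nonneg_left hsum (by norm_num)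
    _ = 2 * ∫ x, latticeDispersion x * ∑ k, ‖latF (fun y => φ y k) x‖ ^ 2 := by
        rw [hN]; ring

end LatticeChain

end Literature.MathematicalPhysics.QuantumFieldTheory
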